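import Summits.BirchSwinnertonDyer.BirchSwinnertonDyer.Theorems.SylvesterTwoHeegnerIndexLevelFixingOrbitFormTransform
import HarnessLib

/-!
# (W2-b) `stub_levelFixingSeven` — ORBIT FORMS on the classes `p ≡ 7, 16 (mod 27)`, II: residues, CM points, and the
# `OrbitForms` datum on EVERY class of `p ≡ 7 (mod 9)` at EVERY level `n` (crux `UpperOffV0HSYPlus`, stmt-BirchSwinnertonDyer-19804)

Cell `bsd-cm`, seat `bsd-cm-k7t-w2b` g0.  Helper toward `stmt-BirchSwinnertonDyer-19804` (`--supports … --as helper`); sequel of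
`…LevelFixingOrbitFormTransform.lean` (the partners `Q_n^{AW}`, `Q_n^{A²W}` as level-`243` Heegner forms) and of k7t-c2 g32's
`…LevelFixingOrbitFormW.lean` (p748618, the W-class).  THEOREMS ONLY (no definition, no named fact, no instance, no notation,
no `sorry`).

CONTENT.  The three reflections `W, AW, A²W` of `S₃ = ⟨W, A⟩ ≤ Aut X₀(3⁵)` (HSY §2.1) carry HSY's CM point `τ_n` to the CM
points of three level-`243` Heegner forms of discriminant `(9pn)²·(−3)`; their residues modulo `2·243` are pairwise distinct and
EXACTLY ONE equals the residue `nB` of `Q_n` — the one tabulated by the kernel certificate p748342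
(`SylvesterTwoLevelFixingCert.levelFixing_shimura_certificate`: `9ρ_n(√−3) ∈ V₃·A^{a(p)n}W`) and memo (W2-b) §1 (1.3):
`(p mod 27, n mod 3) = (7,1), (16,2) ↦ A²W`; `(7,2), (16,1) ↦ AW`; `(25,·) ↦ W`.

* §4 ★ `partnerAW_residue`, ★ `partnerAsqW_residue` — `B′ ≡ nB (mod 486)` on exactly those classes (with `p = 27s + r`,
  `n = 3t + e`, `B′ − nB = 486 ×` an explicit integer polynomial in `s, t`).
* §5 ★ `heegnerTau_partnerAW`, ★ `heegnerTau_partnerAsqW` — `heegnerTau Q_n^{A^iW} = glCast (hsyA ^ i * frickeGL 243) • heegnerTau Q_n`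
  (`i = 1, 2`), the currency of `IsS3Invariant.hsyA_pow_mul_frickeGL_smul` (k-ty1 p749218).
* §6 ★ `orbitForm_AW_sylvesterTower`, ★ `orbitForm_AsqW_sylvesterTower` (the A-class twins of `orbitForm_W_sylvesterTower`) and
  ★★ `orbitForm_sylvesterTower` — for EVERY `p ≡ 7 (mod 9)` and every `n ≠ 0` with all prime factors `≡ 2 (mod 3)`:
  `∃ i < 3, ∃ Q′ ∈ heegnerForms 243 ((9pn)²·(−3))` with `Q′.2.1 ≡ nB [ZMOD 486]` and
  `heegnerTau Q′ = glCast (hsyA ^ i * frickeGL 243) • heegnerTau Q_n` — the uniform `(hQ₂, hβ₂)` / `OrbitForms` input of B-I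
  `exists_ringEquiv_levelTransport_of_residue_congr_bezout`, of the engine `levelTransport_of_transport_lattice_eq_bezout`, of
  idea `s3-fibre-transport-w2b`, and of the glue `SylvesterTwoLevelFixingGlue` (p749244) on all three classes.

NOT HERE: the class identity `[Q′] = η*·[Q_n]` (`η* = [(243, 243pn, 61(pn)²)]`, checked numerically in all six classes — a
sequel in `classOf'` currency); (G2)-consumers; any Galois statement.  HONEST LABEL: no stub closed; nothing asserted on 19804;
X12.CMAtTwo NOT proved; BSD is proved for no curve.

## References
* Y. Hu, J. Shu, H. Yin, *An explicit Gross–Zagier formula related to the Sylvester conjecture*, Trans. AMS 372 (2019) =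
  arXiv:1708.05266, §2.1 Prop. 2.1 (1), §2.2 Thm 2.2–2.3 (case split of `p mod 27`), §4.1 (p. 10). [HuShuYin2019]
* B. H. Gross, *Heegner points on `X₀(N)`* (1984), §I.1, §5. [Gross1984]
* Tree: `…LevelFixingOrbitFormTransform` (this seat), `orbitForm_W_sylvesterTower` (p748618), `hsyA`/`IsS3Invariant` (p749218),
  `isCoprime_C_of_forall_prime_mod_three_eq_two` (`SylvesterCMPointsConductorNineP`).
-/

set_option autoImplicit false
-- the Summit-side namespace `Summit.BirchSwinnertonDyer.BirchSwinnertonDyer.…` (summit = problem) is mandated by D-0017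
set_option linter.dupNamespace false

noncomputable section

open scoped MatrixGroups

namespace Summit.BirchSwinnertonDyer.BirchSwinnertonDyer.Theorems.SylvesterTwoLevelFixingOrbitA

open UpperHalfPlane Complex
open Literature.NumberTheory.EllipticCurves Literature.NumberTheory.EllipticCurves.HeegnerForm
  Literature.NumberTheory.EllipticCurves.HuShuYin2019 Literature.NumberTheory.EllipticCurves.ModularForms
  Summit.BirchSwinnertonDyer.BirchSwinnertonDyer.Theorems.SylvesterTwoLevelFixingOrbit

/-! ## §4 The residues: `B′ ≡ nB (mod 2·243)` exactly on the tabulated classes `(p mod 27, n mod 3)` -/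

/-- ★ **`Q_n^{AW}` has the SAME residue as `Q_n` modulo `2·243` on the classes `(p, n) ≡ (7, 2), (16, 1) (mod 27, 3)`** —
the classes on which the kernel certificate's reflection is `AW` (`SylvesterTwoLevelFixingCert.levelCert_seven_two`,
`levelCert_sixteen_one`: `9ρ_n(√−3) ∈ V₃·AW`).  With `p = 27s + r`, `n = 3t + e` the difference `B′ − nB` is `486` times an
explicit integer polynomial in `s, t`. [cite: HuShuYin2019, §2.2 (Thm 2.2: the case split of p mod 27)] -/
theorem partnerAW_residue {p n : ℕ} (h : p % 27 = 7 ∧ n % 3 = 2 ∨ p % 27 = 16 ∧ n % 3 = 1) :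
    (((243 * (9 * (n : ℤ) ^ 2 * ((p : ℤ) ^ 2 + 4 * p + 16) - 3 * n * (4 * (p : ℤ) ^ 2 + 17 * p + 72) +
        (4 * (p : ℤ) ^ 2 + 18 * p + 81)),
      -(9 * (168 * (n : ℤ) ^ 2 * ((p : ℤ) ^ 2 + 4 * p + 16) - 55 * n * (4 * (p : ℤ) ^ 2 + 17 * p + 72) +
        18 * (4 * (p : ℤ) ^ 2 + 18 * p + 81))),
      784 * (n : ℤ) ^ 2 * (((p : ℤ) ^ 2 + 4 * p + 16) / 3) - 84 * n * (4 * (p : ℤ) ^ 2 + 17 * p + 72) +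
        27 * (4 * (p : ℤ) ^ 2 + 18 * p + 81)) : ℤ × ℤ × ℤ)).2.1 ≡ (n : ℤ) * (-(9 * (4 * (p : ℤ) ^ 2 + 17 * p + 72))) [ZMOD 2 * 243] := by
  refine Int.ModEq.symm ((Int.modEq_iff_dvd).mpr ?_)
  rcases h with ⟨hp, hn⟩ | ⟨hp, hn⟩
  · obtain ⟨s, rfl⟩ : ∃ s : ℕ, p = 27 * s + 7 := ⟨p / 27, by omega⟩
    obtain ⟨t, rfl⟩ : ∃ t : ℕ, n = 3 * t + 2 := ⟨n / 3, by omega⟩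
    refine ⟨-20412 * (s : ℤ) ^ 2 * (t : ℤ) ^ 2 - 18144 * (s : ℤ) ^ 2 * (t : ℤ) - 13608 * (s : ℤ) * (t : ℤ) ^ 2 -
      3996 * (s : ℤ) ^ 2 - 12012 * (s : ℤ) * (t : ℤ) - 2604 * (t : ℤ) ^ 2 - 2626 * (s : ℤ) - 2268 * (t : ℤ) - 489, ?_⟩
    push_cast
    ring
  · obtain ⟨s, rfl⟩ : ∃ s : ℕ, p = 27 * s + 16 := ⟨p / 27, by omega⟩
    obtain ⟨t, rfl⟩ : ∃ t : ℕ, n = 3 * t + 1 := ⟨n / 3, by omega⟩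
    refine ⟨-20412 * (s : ℤ) ^ 2 * (t : ℤ) ^ 2 - 4536 * (s : ℤ) ^ 2 * (t : ℤ) - 27216 * (s : ℤ) * (t : ℤ) ^ 2 -
      216 * (s : ℤ) ^ 2 - 5964 * (s : ℤ) * (t : ℤ) - 9408 * (t : ℤ) ^ 2 - 278 * (s : ℤ) - 2016 * (t : ℤ) - 91, ?_⟩
    push_cast
    ring

/-- ★ **`Q_n^{A²W}` has the SAME residue as `Q_n` modulo `2·243` on the classes `(p, n) ≡ (7, 1), (16, 2) (mod 27, 3)`** —
the classes of `levelCert_seven_one`, `levelCert_sixteen_two` (`9ρ_n(√−3) ∈ V₃·A²W`).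
[cite: HuShuYin2019, §2.2 (Thm 2.2: the case split of p mod 27)] -/
theorem partnerAsqW_residue {p n : ℕ} (h : p % 27 = 7 ∧ n % 3 = 1 ∨ p % 27 = 16 ∧ n % 3 = 2) :
    (((243 * (7569 * (n : ℤ) ^ 2 * ((p : ℤ) ^ 2 + 4 * p + 16) - 2436 * n * (4 * (p : ℤ) ^ 2 + 17 * p + 72) +
        784 * (4 * (p : ℤ) ^ 2 + 18 * p + 81)),
      -(9 * (141114 * (n : ℤ) ^ 2 * ((p : ℤ) ^ 2 + 4 * p + 16) - 45415 * n * (4 * (p : ℤ) ^ 2 + 17 * p + 72) +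
        14616 * (4 * (p : ℤ) ^ 2 + 18 * p + 81))),
      657721 * (n : ℤ) ^ 2 * (((p : ℤ) ^ 2 + 4 * p + 16) / 3) - 70557 * n * (4 * (p : ℤ) ^ 2 + 17 * p + 72) +
        22707 * (4 * (p : ℤ) ^ 2 + 18 * p + 81)) : ℤ × ℤ × ℤ)).2.1 ≡ (n : ℤ) * (-(9 * (4 * (p : ℤ) ^ 2 + 17 * p + 72))) [ZMOD 2 * 243] := by
  refine Int.ModEq.symm ((Int.modEq_iff_dvd).mpr ?_)
  rcases h with ⟨hp, hn⟩ | ⟨hp, hn⟩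
  · obtain ⟨s, rfl⟩ : ∃ s : ℕ, p = 27 * s + 7 := ⟨p / 27, by omega⟩
    obtain ⟨t, rfl⟩ : ∃ t : ℕ, n = 3 * t + 1 := ⟨n / 3, by omega⟩
    refine ⟨-17145351 * (s : ℤ) ^ 2 * (t : ℤ) ^ 2 - 4072842 * (s : ℤ) ^ 2 * (t : ℤ) - 11430234 * (s : ℤ) * (t : ℤ) ^ 2 -
      241839 * (s : ℤ) ^ 2 - 2647104 * (s : ℤ) * (t : ℤ) - 2187267 * (t : ℤ) ^ 2 - 153134 * (s : ℤ) - 481734 * (t : ℤ) -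
      26627, ?_⟩
    push_cast
    ring
  · obtain ⟨s, rfl⟩ : ∃ s : ℕ, p = 27 * s + 16 := ⟨p / 27, by omega⟩
    obtain ⟨t, rfl⟩ : ∃ t : ℕ, n = 3 * t + 2 := ⟨n / 3, by omega⟩
    refine ⟨-17145351 * (s : ℤ) ^ 2 * (t : ℤ) ^ 2 - 15503076 * (s : ℤ) ^ 2 * (t : ℤ) - 22860468 * (s : ℤ) * (t : ℤ) ^ 2 -
      3504492 * (s : ℤ) ^ 2 - 20602644 * (s : ℤ) * (t : ℤ) - 7902384 * (t : ℤ) ^ 2 - 4641856 * (s : ℤ) -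
      7084896 * (t : ℤ) - 1588132, ?_⟩
    push_cast
    ring

/-! ## §5 The CM points: `τ(Q_n^{A^iW}) = (A^i·w₂₄₃) • τ_n` -/

/-- ★ **`heegnerTau Q_n^{AW} = (A·w₂₄₃) • heegnerTau Q_n`** (`p ≡ 1 (mod 3)`, `n ≥ 1`): the CM point of the partner is
the image of HSY's `τ_n` under the reflection `AW` of `S₃ = ⟨W, A⟩ ≤ Aut X₀(3⁵)`, in the currency of
`IsS3Invariant.hsyA_pow_mul_frickeGL_smul` (`i = 1`). [cite: HuShuYin2019, §2.1 (p. 5 L29), §2.2] -/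
theorem heegnerTau_partnerAW {p n : ℕ} (hp : p % 3 = 1) (hn : n ≠ 0) :
    heegnerTau ((243 * (9 * (n : ℤ) ^ 2 * ((p : ℤ) ^ 2 + 4 * p + 16) - 3 * n * (4 * (p : ℤ) ^ 2 + 17 * p + 72) +
        (4 * (p : ℤ) ^ 2 + 18 * p + 81)),
      -(9 * (168 * (n : ℤ) ^ 2 * ((p : ℤ) ^ 2 + 4 * p + 16) - 55 * n * (4 * (p : ℤ) ^ 2 + 17 * p + 72) +
        18 * (4 * (p : ℤ) ^ 2 + 18 * p + 81))),
      784 * (n : ℤ) ^ 2 * (((p : ℤ) ^ 2 + 4 * p + 16) / 3) - 84 * n * (4 * (p : ℤ) ^ 2 + 17 * p + 72) +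
        27 * (4 * (p : ℤ) ^ 2 + 18 * p + 81)) : ℤ × ℤ × ℤ) = glCast (hsyA ^ 1 * (frickeGL 243 : GL (Fin 2) ℚ)) • heegnerTau ((n : ℤ) ^ 2 * (81 * ((p : ℤ) ^ 2 + 4 * p + 16)),
          (n : ℤ) * (-(9 * (4 * (p : ℤ) ^ 2 + 17 * p + 72))), 4 * (p : ℤ) ^ 2 + 18 * p + 81) := by
  have hp0 : 0 < p := by omega
  have hn0 : (0 : ℤ) < n := by exact_mod_cast Nat.pos_of_ne_zero hn
  have hA : (0 : ℤ) < (n : ℤ) ^ 2 * (81 * ((p : ℤ) ^ 2 + 4 * p + 16)) := by positivity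
  obtain ⟨h₁, h₂, h₃⟩ := smul_partnerAW_eq_compAdj hp n
  refine heegnerTau_eq_glCast_smul_of_smul_eq_compAdj (F := (_, _, _)) (Q' := (_, _, _)) (a := 81) (b := -28)
    (c := 243) (d := -81) (l := 243) hA (disc_sylvesterForm_neg hp0 hn) (by norm_num) (by norm_num) h₁ h₂ h₃ ?_
  rw [pow_one, coe_hsyA_mul_frickeGL]

/-- ★ **`heegnerTau Q_n^{A²W} = (A²·w₂₄₃) • heegnerTau Q_n`** (`p ≡ 1 (mod 3)`, `n ≥ 1`; `i = 2` in
`IsS3Invariant.hsyA_pow_mul_frickeGL_smul`). [cite: HuShuYin2019, §2.1 (p. 5 L29), §2.2] -/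
theorem heegnerTau_partnerAsqW {p n : ℕ} (hp : p % 3 = 1) (hn : n ≠ 0) :
    heegnerTau ((243 * (7569 * (n : ℤ) ^ 2 * ((p : ℤ) ^ 2 + 4 * p + 16) - 2436 * n * (4 * (p : ℤ) ^ 2 + 17 * p + 72) +
        784 * (4 * (p : ℤ) ^ 2 + 18 * p + 81)),
      -(9 * (141114 * (n : ℤ) ^ 2 * ((p : ℤ) ^ 2 + 4 * p + 16) - 45415 * n * (4 * (p : ℤ) ^ 2 + 17 * p + 72) +
        14616 * (4 * (p : ℤ) ^ 2 + 18 * p + 81))),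
      657721 * (n : ℤ) ^ 2 * (((p : ℤ) ^ 2 + 4 * p + 16) / 3) - 70557 * n * (4 * (p : ℤ) ^ 2 + 17 * p + 72) +
        22707 * (4 * (p : ℤ) ^ 2 + 18 * p + 81)) : ℤ × ℤ × ℤ) = glCast (hsyA ^ 2 * (frickeGL 243 : GL (Fin 2) ℚ)) • heegnerTau ((n : ℤ) ^ 2 * (81 * ((p : ℤ) ^ 2 + 4 * p + 16)),
          (n : ℤ) * (-(9 * (4 * (p : ℤ) ^ 2 + 17 * p + 72))), 4 * (p : ℤ) ^ 2 + 18 * p + 81) := by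
  have hp0 : 0 < p := by omega
  have hn0 : (0 : ℤ) < n := by exact_mod_cast Nat.pos_of_ne_zero hn
  have hA : (0 : ℤ) < (n : ℤ) ^ 2 * (81 * ((p : ℤ) ^ 2 + 4 * p + 16)) := by positivity
  obtain ⟨h₁, h₂, h₃⟩ := smul_partnerAsqW_eq_compAdj hp n
  exact heegnerTau_eq_glCast_smul_of_smul_eq_compAdj (F := (_, _, _)) (Q' := (_, _, _)) (a := 2349) (b := -811)
    (c := 6804) (d := -2349) (l := 243) hA (disc_sylvesterForm_neg hp0 hn) (by norm_num) (by norm_num) h₁ h₂ h₃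
    coe_hsyA_sq_mul_frickeGL

/-! ## §6 Assembly: the `OrbitForms` datum on every class of `p ≡ 7 (mod 9)` -/

/-- ★ **ORBIT FORMS on the classes of the reflection `AW`** (`(p, n) ≡ (7, 2), (16, 1) (mod 27, 3)`).  Under the binders of
`stub_levelFixingSeven` — `p ≡ 7 (mod 9)`, `n ≠ 0`, every prime factor of `n` is `≡ 2 (mod 3)` — restricted to these classes,
the CM point `(A·w₂₄₃) • τ_n` (to which the decomposition involution at `w = (√−3)` carries `x(τ_n)`: kernel certificate
`levelCert_seven_two` / `levelCert_sixteen_one` + HSY Thm 2.3) is the Heegner point of a level-`243` Heegner form `Q′` of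
the SAME discriminant and the SAME residue mod `2·243` as `Q_n` — namely `Q′ = Q_n^{AW}`: the `(hQ₂, hβ₂)` input of B-I
`exists_ringEquiv_levelTransport_of_residue_congr_bezout` / of the engine on these classes.  No Galois statement is made.
[cite: HuShuYin2019, §2.1–2.2, §4.1] [cite: Gross1984, §I.1, §5] -/
theorem orbitForm_AW_sylvesterTower {p : ℕ} (h9 : p % 9 = 7) {n : ℕ} (hn : n ≠ 0)
    (hprimes : ∀ q ∈ n.primeFactors, q % 3 = 2) (hcls : p % 27 = 7 ∧ n % 3 = 2 ∨ p % 27 = 16 ∧ n % 3 = 1) :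
    ∃ Q' ∈ heegnerForms 243 (((9 * p * n : ℕ) : ℤ) ^ 2 * (-3)),
      Q'.2.1 ≡ (n : ℤ) * (-(9 * (4 * (p : ℤ) ^ 2 + 17 * p + 72))) [ZMOD 2 * 243] ∧
      heegnerTau Q' = glCast (hsyA ^ 1 * (frickeGL 243 : GL (Fin 2) ℚ)) • heegnerTau ((n : ℤ) ^ 2 * (81 * ((p : ℤ) ^ 2 + 4 * p + 16)),
          (n : ℤ) * (-(9 * (4 * (p : ℤ) ^ 2 + 17 * p + 72))), 4 * (p : ℤ) ^ 2 + 18 * p + 81) := by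
  have hp3 : p % 3 = 1 := by omega
  have hn3 : ¬ 3 ∣ n := by
    intro h
    have h3 := hprimes 3 (Nat.mem_primeFactors.mpr ⟨Nat.prime_three, h, hn⟩)
    omega
  have hnC := isCoprime_C_of_forall_prime_mod_three_eq_two (p := p) hn hprimes
  exact ⟨_, partnerAW_mem_heegnerForms hp3 hn hn3 hnC, partnerAW_residue hcls, heegnerTau_partnerAW hp3 hn⟩

/-- ★ **ORBIT FORMS on the classes of the reflection `A²W`** (`(p, n) ≡ (7, 1), (16, 2) (mod 27, 3)`): `Q′ = Q_n^{A²W}` with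
`heegnerTau Q′ = (A²·w₂₄₃) • τ_n` (kernel certificate `levelCert_seven_one` / `levelCert_sixteen_two`).
[cite: HuShuYin2019, §2.1–2.2, §4.1] [cite: Gross1984, §I.1, §5] -/
theorem orbitForm_AsqW_sylvesterTower {p : ℕ} (h9 : p % 9 = 7) {n : ℕ} (hn : n ≠ 0)
    (hprimes : ∀ q ∈ n.primeFactors, q % 3 = 2) (hcls : p % 27 = 7 ∧ n % 3 = 1 ∨ p % 27 = 16 ∧ n % 3 = 2) :
    ∃ Q' ∈ heegnerForms 243 (((9 * p * n : ℕ) : ℤ) ^ 2 * (-3)),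
      Q'.2.1 ≡ (n : ℤ) * (-(9 * (4 * (p : ℤ) ^ 2 + 17 * p + 72))) [ZMOD 2 * 243] ∧
      heegnerTau Q' = glCast (hsyA ^ 2 * (frickeGL 243 : GL (Fin 2) ℚ)) • heegnerTau ((n : ℤ) ^ 2 * (81 * ((p : ℤ) ^ 2 + 4 * p + 16)),
          (n : ℤ) * (-(9 * (4 * (p : ℤ) ^ 2 + 17 * p + 72))), 4 * (p : ℤ) ^ 2 + 18 * p + 81) := by
  have hp3 : p % 3 = 1 := by omega
  have hn3 : ¬ 3 ∣ n := by
    intro h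
    have h3 := hprimes 3 (Nat.mem_primeFactors.mpr ⟨Nat.prime_three, h, hn⟩)
    omega
  have hnC := isCoprime_C_of_forall_prime_mod_three_eq_two (p := p) hn hprimes
  exact ⟨_, partnerAsqW_mem_heegnerForms hp3 hn hn3 hnC, partnerAsqW_residue hcls, heegnerTau_partnerAsqW hp3 hn⟩

/-- ★★ **ORBIT FORMS, ALL CLASSES of `p ≡ 7 (mod 9)`, EVERY level `n`.**  Under the binders of `stub_levelFixingSeven`
(`p ≡ 7 (mod 9)` — primality of `p` is not needed —, `n ≠ 0`, every prime factor of `n` is `≡ 2 (mod 3)`) there are an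
exponent `i < 3` and a level-`243` Heegner form `Q′` of discriminant `(9pn)²·(−3)` with the SAME residue as `Q_n` modulo
`2·243` whose CM point is `(Aⁱ·w₂₄₃) • τ_n` — `i = a(p)·n mod 3`, `a = 2, 1, 0` for `p ≡ 7, 16, 25 (mod 27)`, the table of
the kernel certificate `SylvesterTwoLevelFixingCert.levelFixing_shimura_certificate` (p748342) and of memo (W2-b) §1 (1.3):
`i = 0` (W-class, `orbitForm_W_sylvesterTower` p748618), `i = 1` (`orbitForm_AW_sylvesterTower`), `i = 2`
(`orbitForm_AsqW_sylvesterTower`).  Hence `Dt.φ (heegnerTau Q′) = Dt.φ (τ_n)` for every `⟨W, A⟩`-invariant datum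
(`IsS3Invariant.hsyA_pow_mul_frickeGL_smul`).  This is the uniform `OrbitForms` input of the (W2-b) reductions (B-I / engine
/ glue `SylvesterTwoLevelFixingGlue`); no Galois statement is made, no stub is closed.
[cite: HuShuYin2019, §2.1 Prop. 2.1 (1), §2.2 Thm 2.2–2.3, §4.1] [cite: Gross1984, §I.1, §5] -/
theorem orbitForm_sylvesterTower {p : ℕ} (h9 : p % 9 = 7) {n : ℕ} (hn : n ≠ 0)
    (hprimes : ∀ q ∈ n.primeFactors, q % 3 = 2) :
    ∃ i : ℕ, i < 3 ∧ ∃ Q' ∈ heegnerForms 243 (((9 * p * n : ℕ) : ℤ) ^ 2 * (-3)),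
      Q'.2.1 ≡ (n : ℤ) * (-(9 * (4 * (p : ℤ) ^ 2 + 17 * p + 72))) [ZMOD 2 * 243] ∧
      heegnerTau Q' = glCast (hsyA ^ i * (frickeGL 243 : GL (Fin 2) ℚ)) • heegnerTau ((n : ℤ) ^ 2 * (81 * ((p : ℤ) ^ 2 + 4 * p + 16)),
          (n : ℤ) * (-(9 * (4 * (p : ℤ) ^ 2 + 17 * p + 72))), 4 * (p : ℤ) ^ 2 + 18 * p + 81) := by
  have hn3 : ¬ 3 ∣ n := by
    intro h
    have h3 := hprimes 3 (Nat.mem_primeFactors.mpr ⟨Nat.prime_three, h, hn⟩)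
    omega
  have h27 : p % 27 = 7 ∨ p % 27 = 16 ∨ p % 27 = 25 := by omega
  have hn' : n % 3 = 1 ∨ n % 3 = 2 := by omega
  rcases h27 with h7 | h16 | h25
  · rcases hn' with h1 | h2
    · exact ⟨2, by norm_num, orbitForm_AsqW_sylvesterTower h9 hn hprimes (Or.inl ⟨h7, h1⟩)⟩
    · exact ⟨1, by norm_num, orbitForm_AW_sylvesterTower h9 hn hprimes (Or.inl ⟨h7, h2⟩)⟩
  · rcases hn' with h1 | h2
    · exact ⟨1, by norm_num, orbitForm_AW_sylvesterTower h9 hn hprimes (Or.inr ⟨h16, h1⟩)⟩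
    · exact ⟨2, by norm_num, orbitForm_AsqW_sylvesterTower h9 hn hprimes (Or.inr ⟨h16, h2⟩)⟩
  · obtain ⟨Q', hQ', hres, hτ⟩ := SylvesterTwoLevelFixingOrbit.orbitForm_W_sylvesterTower h9 h25 hn hprimes
    exact ⟨0, by norm_num, Q', hQ', hres, by rw [pow_zero, one_mul]; exact hτ⟩

end Summit.BirchSwinnertonDyer.BirchSwinnertonDyer.Theorems.SylvesterTwoLevelFixingOrbitA

end
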